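/-
COR-CM (cell pub-hodgecm2, stage 2 of the Hodge ladder) — TRANSPOSITION SURGE, DICTIONARY ITEM (vi) of rfwf v3 §4.2
(tex ll. 261–265): archimedean bookkeeping (PerL Lemma 4.1) · SUPPLY of one-forms + NON-VANISHING of theta lifts
(Lemma 4.2, Kronecker + Rallis) · non-zero wedge (Prop 4.3) · assembly with ∃(V₃,h) (Thm 4.4).
TYPED INTERFACE (day 1, INTERFACE-FIRST; COORDINATOR RE-POINT 2026-08-21T12:07:17Z (3); hodge-director/TRANSPOSITION-MAP.md
§0 row «tr-typer-6 → tr-prover-6», file name and ∃V/∃level form named there).  Typer: prover-pub-hodgecm2-tr-typer-6-0.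
Statements only (structures / `def … : Prop` / binder-style hypotheses) plus kernel glue between them; NO axiom, NO
`sorry`, nothing cited as a record, nothing asserted.  FRAMING (COORDINATOR RULING 2026-08-21T11:55:35Z): HC_CM is NOT
proved; no declaration below inhabits any displayed hypothesis.

TAG OF ITEM (vi) (TRANSPOSITION-MAP §0-v3 «FINAL NET OF THE EARLY CUT», suppliers' words; one line each):
  (vi-a) Lemma 4.1 archimedean bookkeeping ........ VERBATIM — μ₀ table is rank-keyed and field-generic (own-mu: PKG
         `Model/ArchMuClosedForm.lean:66 muSlotZero`, `Model/ArchSlotDeltaDischarge23.lean:97 muSharp₂₃`, forcing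
         identities `Model/ArchSlotBoxTorusType.lean:495`, `Model/ArchConjSlotVT.lean:104/111`, all `∀ {L : CMField}`);
         purely local (rfwf l. 261); on the tree side it has NO separate field: it is what makes `Theta_sub` true.
  (vi-b) Lemma 4.2 supply + non-vanishing ......... VERBATIM by cite — [GR91 Prop 3.1.1] degree-uniform AS CITED (GR-1/GR-2;
         PKG binder `hGRU` E term «UARM» `Model/E2InstanceOGR21AEPISTR2DJWHHTCGUARM.lean:60–63`; tree record
         `Literature/NumberTheory/GelbartRogawski1991/CompatibleSplitting.lean:202`), Rallis inner product in Weil's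
         convergent range for (U(1),U(3)) (tree skeletons `Literature/NumberTheory/Li1992/RallisInnerProduct.lean:90`,
         `…/Li1992/StableRange.lean:117`); PKG `Open_supply` `Automorphic/ThetaWedgeSplit.lean:109`, discharged
         `Model/SupplyDischarge.lean:261 open_supply_of_classSupplyPack`.
  (vi-c) Prop 4.3 non-zero wedge .................. VERBATIM — PKG `Open_thetaWedge` `Automorphic/ThetaFacts.lean:187`,
         proved by the Hecke route `Automorphic/HeckeWedge.lean:146 exists_cup_ne_zero_of_hecke` (Venkataramana 2001
         Thm 8 `Fact_virtualCup` :90 + `Open_heckeTheta` :110 + supply); tree shadow B01-H `Universe.HeckeWedge10`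
         (`B01/FaceInputsSplit.lean:177`; `Model.heckeWedge10_holds` p260689 in review).
  (vi-d) Thm 4.4 assembly, ∃(V₃,h) ................ VERBATIM — PKG `StubTree/PerLProof.lean:142 thm44_of_realisation`,
         `:205 periodThmF_holds`; tree engine `Universe.periodNV_of_faceThetaDatum` (`B01/ThetaRealisationSocket.lean:106`);
         the ∃(V₃,h) is the ∃V of `Universe.FaceThetaDataExists` (`B01/Transposition/Assembly.lean`, p271429).
  V-SENSITIVE (director): (vi-b) — so the closed statement `FaceThetaSupplyWedgeExists` below is in the ∃ι₁ ∃V ∃Γ form.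

STAGE-1 DECLARATIONS GENERALISED (PKG root `run/shared/lean/pub/pub-hodgecm/lean/HodgeCMPerL/HodgeCM/`):
  `Universe.ThetaRealisation` `Automorphic/Realisation.lean:102` — fields `Theta` :126, `Theta_sub` :128, `lineField` :134,
  derived `ThetaRealisation.supply` :166;  `ThetaModel.Open_thetaSub/Open_thetaWedge/Open_supply` (`Automorphic/ThetaFacts.lean
  :162/:187`, `Automorphic/ThetaWedgeSplit.lean:109`);  `Universe.HeckeData` / `Fact_virtualCup` / `Open_heckeTheta` /
  `Fact_coverTheta` (`Automorphic/HeckeWedge.lean:75/:90/:110/:121`);  `Universe.RealisationExistsFace` (`StubTree/Inputs.lean:97`,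
  ∀V) — re-typed per context, closed in the ∃V form;  E-term binder `hΘ` («UARM» :64–70: theta classes ⊆ span of surface classes).
TREE DECLARATIONS FED: socket fields `Theta` :76, `Theta_sub` :78, `lineField` :80 of `Universe.FaceThetaDatum` (`B01/ThetaRealisationSocket
.lean:66`); leaves B01-S `Universe.FaceSupply` (`B01/FaceInputsSplit.lean:50`), B01-L `Universe.FaceLineField` (`B01/FaceSkeleton.lean:87`), ∃-forms.
-/
import Summits.HodgeConjecture.CorCM.B01.ThetaRealisationSocketNonVacuity
import HarnessLib

/-!
# Transposition item (vi): theta SUPPLY, non-vanishing, the non-zero wedge, and the ∃(V₃,h) assembly — typed interface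

What item (vi) must deliver toward `RealisationExistsFace∃` (= `Universe.FaceThetaDataExists`, socket form), at a face
context `(F, f, ι₁, V)` with one-form field `K = F`, types `Ψ = f.psi`, eigen-embedding `σ = ι₁`:

* `Transposition.FaceThetaSupply U ι₁ V K Ψ σ` (DATA, §1) — the theta one-form sets `Theta i Γ ⊆ H¹(P_Γ(V), ℂ)` per type
  and level (PerL Lemma 4.2: theta lifts `θ_φ(χ′)` of automorphic characters `χ′` of `[U(1)]` with the archimedean exponents
  forced by `Ψ_i`, Kronecker), with `Theta_sub` (`Theta i Γ ⊆ U_{Ψ_i}(Γ)`: PerL Lemma 3.3(a)/Prop 2.2, [Y1neg] Thm 8.1(a),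
  [Liu 2021 Thm 4.18] — where Lemma 4.1's archimedean bookkeeping is consumed) and `supply` (Lemma 4.2(a) NON-VANISHING: at one
  level, a non-zero theta one-form of type `Ψ₀` and one of type `Ψ₁` — Rallis' inner product formula, [GR91 Prop 3.1.1]).
* `FaceThetaSupply.Wedge S` (Prop, §1) — PerL Prop 4.3 for `S`, cohomological form: at some level a theta (12)-wedge `ω₁ ∪ ω₂ ≠ 0`.
* §2, the Hecke route to Prop 4.3 (VERBATIM transposition of the package's `exists_cup_ne_zero_of_hecke`): a posited family
  `HeckeFamily.tr Γ Γ'` of morphisms `P_{Γ'} → P_Γ` (intended: Hecke-translated level coverings), closure of the theta sets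
  under pull-back along it (`TranslateClosed`, PerL §3.1 ll. 652–656), and B01-H with witnesses IN the family
  (`HeckeWedge10Within`; forgetting the family gives the tree's `Universe.HeckeWedge10`) ⇒ `S.Wedge`.
* §3, bridge to the socket: `S.Wedge` + item (iii)'s Petersson identity `inner_emb` + Hodge–Riemann (2,0) (a THEOREM on the
  model universe, `Model.universeOf_hodgeRiemann_pms`) ⇒ the socket field `lineField` (`emb Γ (ω₁ ∪ ω₂) ≠ 0`); the
  constructor `FaceThetaSupply.toFaceThetaDatum` names exactly which socket fields item (vi) supplies (`Theta`, `Theta_sub`,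
  `lineField`) and which it takes from items (i)/(iii) (`HG`, `emb`, `cover`, `emb_cover`, `inner_emb`) and (v) (`coupling`).
* §4, the TYPED AXIOM of item (vi) as ONE closed statement in the ∃ι₁ ∃V ∃Γ form (`FaceThetaSupplyWedgeExists`), its
  projections to the ∃-witness forms of B01-S / B01-L, the `∀V → ∃V` comparison, and its falsity on the PerL shadow
  (so it is not a universe-uniform consequence of `PerL`).
-/

noncomputable section

open scoped TensorProduct InnerProductSpace

namespace Summit.HodgeConjecture.CorCM

open Literature.AlgebraicGeometry.Motives (CMType HodgeStructure)
open Literature.AlgebraicGeometry.Motives.HodgeStructure (conj)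

namespace Transposition

/-! ## §1  Item (vi-a)(vi-b): the theta supply datum at a face context; (vi-c): Prop 4.3 for it -/

/-- **Item (vi) SUPPLY DATUM** at a context `(L, ι₁, V; K, Ψ, σ)` (face setting: `K = L = F`, `Ψ = f.psi`, `σ = ι₁`).
rfwf v3 §4.2 (vi), tex ll. 261–263: PerL Lemma 4.1 (archimedean bookkeeping, purely local) and Lemma 4.2 (supply of
one-forms: automorphic characters of `[U(1)]` with arbitrary archimedean exponents by Kronecker; non-vanishing of the theta
lifts by Rallis' inner product formula in Weil's convergent range for `(U(1),U(3))`).  Generalises the PKG fields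
`ThetaRealisation.Theta/Theta_sub` (`Automorphic/Realisation.lean:126/128`) and `ThetaRealisation.supply` (:166) / `Open_supply`
(`Automorphic/ThetaWedgeSplit.lean:109`); feeds the socket fields `Theta`/`Theta_sub` (`B01/ThetaRealisationSocket.lean:76/78`).
DATA (a `Type`), asserted by no one. -/
structure FaceThetaSupply (U : Universe) {L : CMField} (ι₁ : L →+* ℂ) (V : HermSpace3 L ι₁) (K : CMField)
    (Ψ : Fin 4 → CMType K) (σ : K →+* ℂ) : Type where
  /-- the theta one-forms of type `Ψ i` at level `Γ` (PerL Lemma 4.2; tex ll. 527–638 of PerL v5) -/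
  Theta : Fin 4 → ∀ Γ : Level V, Set (U.CohC (U.pms L ι₁ V Γ) 1)
  /-- PerL Lemma 3.3(a)/Prop 2.2 with Lemma 4.1, [Y1neg] Thm 8.1(a), [Liu 2021 Thm 4.18]: theta one-forms of type `Ψ i` are
  `A_{Ψ i}`-isotypic `σ`-eigen holomorphic one-forms (PKG `Open_thetaSub` `Automorphic/ThetaFacts.lean:162`; E-term binder `hΘ`) -/
  Theta_sub : ∀ (i : Fin 4) (Γ : Level V), Theta i Γ ⊆ U.Uiso Γ K (Ψ i) σ
  /-- PerL Lemma 4.2(a) NON-VANISHING (Rallis / [GR91 Prop 3.1.1]): at one level, non-zero theta one-forms of types `Ψ₀`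
  and `Ψ₁` (PKG `ThetaRealisation.supply` `Automorphic/Realisation.lean:166`, shape verbatim) -/
  supply : ∃ Γ : Level V, (∃ ω₀ ∈ Theta 0 Γ, ω₀ ≠ 0) ∧ (∃ ω₁ ∈ Theta 1 Γ, ω₁ ≠ 0)

namespace FaceThetaSupply

variable {U : Universe} {L : CMField} {ι₁ : L →+* ℂ} {V : HermSpace3 L ι₁} {K : CMField} {Ψ : Fin 4 → CMType K}
  {σ : K →+* ℂ}

/-- **Item (vi-c): PerL Prop 4.3 for the supply datum `S`, cohomological form** (rfwf l. 263–264; PKG `Open_thetaWedge`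
`Automorphic/ThetaFacts.lean:187`, shape verbatim): at some level there are theta one-forms `ω₁` of type `Ψ₀` and `ω₂` of
type `Ψ₁` with `ω₁ ∪ ω₂ ≠ 0` in `H²(P_Γ, ℂ)`. [folklore] -/
@[folklore]
def Wedge (S : FaceThetaSupply U ι₁ V K Ψ σ) : Prop :=
  ∃ Γ : Level V, ∃ ω₁ ∈ S.Theta 0 Γ, ∃ ω₂ ∈ S.Theta 1 Γ, U.cup2C (U.pms L ι₁ V Γ) 1 ω₁ ω₂ ≠ 0

/-- A non-zero wedge has non-zero factors: the cohomological Prop 4.3 gives the supply clause back (the direction by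
which PKG gen 7 derived `ThetaRealisation.supply` from `lineField`). [folklore] -/
theorem supply_of_wedge {Theta : Fin 4 → ∀ Γ : Level V, Set (U.CohC (U.pms L ι₁ V Γ) 1)}
    (h : ∃ Γ : Level V, ∃ ω₁ ∈ Theta 0 Γ, ∃ ω₂ ∈ Theta 1 Γ, U.cup2C (U.pms L ι₁ V Γ) 1 ω₁ ω₂ ≠ 0) :
    ∃ Γ : Level V, (∃ ω₀ ∈ Theta 0 Γ, ω₀ ≠ 0) ∧ (∃ ω₁ ∈ Theta 1 Γ, ω₁ ≠ 0) := by
  obtain ⟨Γ, ω₁, h₁, ω₂, h₂, hne⟩ := h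
  refine ⟨Γ, ⟨ω₁, h₁, ?_⟩, ⟨ω₂, h₂, ?_⟩⟩
  · rintro rfl
    exact hne (by rw [map_zero, LinearMap.zero_apply])
  · rintro rfl
    exact hne (by rw [map_zero])

/-- Smart constructor for the DIRECT route to Prop 4.3 (PerL's own density argument, PKG `Proofs/LineField.lean:89
lineField_false`): theta sets with `Theta_sub` and a non-zero wedge give a supply datum satisfying `Wedge`. [folklore] -/
def ofWedge (Theta : Fin 4 → ∀ Γ : Level V, Set (U.CohC (U.pms L ι₁ V Γ) 1))
    (Theta_sub : ∀ (i : Fin 4) (Γ : Level V), Theta i Γ ⊆ U.Uiso Γ K (Ψ i) σ)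
    (wedge : ∃ Γ : Level V, ∃ ω₁ ∈ Theta 0 Γ, ∃ ω₂ ∈ Theta 1 Γ, U.cup2C (U.pms L ι₁ V Γ) 1 ω₁ ω₂ ≠ 0) :
    FaceThetaSupply U ι₁ V K Ψ σ :=
  ⟨Theta, Theta_sub, supply_of_wedge wedge⟩

/-- **Projection to the B01-S shape at this context** (`Universe.FaceSupply`, `B01/FaceInputsSplit.lean:50`, one instance):
a level with non-zero classes of `U_{Ψ₀}(Γ)` and `U_{Ψ₁}(Γ)`. [folklore] -/
theorem exists_Uiso_ne_zero (S : FaceThetaSupply U ι₁ V K Ψ σ) :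
    ∃ (Γ : Level V) (ω₀ ω₁ : U.CohC (U.pms L ι₁ V Γ) 1),
      ω₀ ∈ U.Uiso Γ K (Ψ 0) σ ∧ ω₁ ∈ U.Uiso Γ K (Ψ 1) σ ∧ ω₀ ≠ 0 ∧ ω₁ ≠ 0 := by
  obtain ⟨Γ, ⟨ω₀, h₀, hne₀⟩, ⟨ω₁, h₁, hne₁⟩⟩ := S.supply
  exact ⟨Γ, ω₀, ω₁, S.Theta_sub 0 Γ h₀, S.Theta_sub 1 Γ h₁, hne₀, hne₁⟩

/-- **Projection to the B01-L shape at this context** (`Universe.FaceLineField`, `B01/FaceSkeleton.lean:87`, one instance):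
`Wedge` gives a non-zero (12)-wedge of `U_Ψ`-classes. [folklore] -/
theorem exists_Uiso_cup_ne_zero (S : FaceThetaSupply U ι₁ V K Ψ σ) (h : S.Wedge) :
    ∃ (Γ : Level V) (ω₀ ω₁ : U.CohC (U.pms L ι₁ V Γ) 1),
      ω₀ ∈ U.Uiso Γ K (Ψ 0) σ ∧ ω₁ ∈ U.Uiso Γ K (Ψ 1) σ ∧ U.cup2C (U.pms L ι₁ V Γ) 1 ω₀ ω₁ ≠ 0 := by
  obtain ⟨Γ, ω₁, h₁, ω₂, h₂, hne⟩ := h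
  exact ⟨Γ, ω₁, ω₂, S.Theta_sub 0 Γ h₁, S.Theta_sub 1 Γ h₂, hne⟩

end FaceThetaSupply

/-! ## §2  The Hecke route to Prop 4.3: translate-closure of the theta sets + B01-H with remembered witnesses -/

/-- **Hecke families of the towers** (posited datum; PKG `Universe.HeckeData` `Automorphic/HeckeWedge.lean:75`, verbatim up
to the tree's `U.Mor`): for two levels `Γ, Γ'` of the tower of `(V₃,h)`, a set of morphisms `P_{Γ'} → P_Γ`; intended: the
Hecke-translated coverings `[x] ↦ [γx]`, `γ ∈ U(V₃,h)(L₀)` with `γ Γ' γ⁻¹ ≤ Γ` (tree: `Level.heckePair`,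
`B01/HeckePair.lean:76`; `exists_heckeTranslate` :207; the coverings are the case `γ = 1`, `B01/LevelCovering.lean:136`). -/
structure HeckeFamily (U : Universe) : Type 1 where
  /-- the distinguished morphisms `P_{Γ'} → P_Γ` -/
  tr : ∀ {L : CMField} {ι₁ : L →+* ℂ} {V : HermSpace3 L ι₁} (Γ Γ' : Level V),
    Set (U.Mor (U.pms L ι₁ V Γ') (U.pms L ι₁ V Γ))

/-- **Translate-closure of the theta sets** (PerL §3.1 / proof of Prop 4.3, tex ll. 652–656 of PerL v5: `γ^* u_f = u_{R(γ_f⁻¹) f}`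
and `R(γ_f⁻¹) θ(φ, χ′) = θ(ω(γ_f⁻¹)φ, χ′)`; PKG `Open_heckeTheta` `Automorphic/HeckeWedge.lean:110` and `Fact_coverTheta` :121
merged): the pull-back of a theta one-form of type `Ψ_i` along a morphism of the Hecke family is a theta one-form of type
`Ψ_i`. [folklore] -/
@[folklore]
def FaceThetaSupply.TranslateClosed {U : Universe} {L : CMField} {ι₁ : L →+* ℂ} {V : HermSpace3 L ι₁} {K : CMField}
    {Ψ : Fin 4 → CMType K} {σ : K →+* ℂ} (S : FaceThetaSupply U ι₁ V K Ψ σ) (Hk : HeckeFamily U) : Prop :=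
  ∀ (i : Fin 4) (Γ Γ' : Level V), ∀ g ∈ Hk.tr Γ Γ', ∀ η ∈ S.Theta i Γ, U.pullC g 1 η ∈ S.Theta i Γ'

/-- **B01-H with remembered witnesses** (Venkataramana, Compositio Math. 125 (2001) Thm 8 for `SU(2,1)`, degrees `1 + 1 ≤ 2`,
holomorphic classes: Clozel, J. reine angew. Math. 444 (1993); PKG `Fact_virtualCup` `Automorphic/HeckeWedge.lean:90`): two
non-zero `(1,0)`-classes on `P_Γ` have a non-zero cup product after pull-back along two morphisms OF THE HECKE FAMILY to a
common finer level.  Forgetting the family gives the tree's displayed leaf `Universe.HeckeWedge10`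
(`B01/FaceInputsSplit.lean:177`; `heckeWedge10_of_within`).  Displayed hypothesis shape; not asserted. [folklore] -/
@[folklore]
def HeckeWedge10Within (U : Universe) (Hk : HeckeFamily U) : Prop :=
  ∀ (L : CMField) (ι₁ : L →+* ℂ) (V : HermSpace3 L ι₁) (Γ : Level V) (a a' : U.CohC (U.pms L ι₁ V Γ) 1),
    a ∈ (U.hodge (U.pms L ι₁ V Γ) 1).piece 1 0 → a' ∈ (U.hodge (U.pms L ι₁ V Γ) 1).piece 1 0 → a ≠ 0 → a' ≠ 0 →
      ∃ (Γ' : Level V), ∃ g ∈ Hk.tr Γ Γ', ∃ h ∈ Hk.tr Γ Γ',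
        U.cup2C (U.pms L ι₁ V Γ') 1 (U.pullC g 1 a) (U.pullC h 1 a') ≠ 0

/-- `HeckeWedge10Within U Hk → U.HeckeWedge10` (forget the family). [folklore] -/
theorem heckeWedge10_of_within {U : Universe} {Hk : HeckeFamily U} (h : HeckeWedge10Within U Hk) : U.HeckeWedge10 := by
  intro L ι₁ V Γ a a' ha ha' hne hne'
  obtain ⟨Γ', g, -, h', -, hcup⟩ := h L ι₁ V Γ a a' ha ha' hne hne'
  exact ⟨Γ', g, h', hcup⟩

/-- **Prop 4.3 by the Hecke route** (VERBATIM transposition of PKG `exists_cup_ne_zero_of_hecke` `Automorphic/HeckeWedge.lean:146`):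
supply (non-zero theta one-forms of types `Ψ₀, Ψ₁` at one level; they are `(1,0)`-classes by `Theta_sub` and `U_Ψ ⊆ H^{1,0}`,
`Universe.Uiso_le_piece10`) + B01-H within the Hecke family + translate-closure ⇒ a non-zero theta (12)-wedge. [folklore] -/
theorem FaceThetaSupply.wedge_of_translateClosed {U : Universe} {L : CMField} {ι₁ : L →+* ℂ} {V : HermSpace3 L ι₁}
    {K : CMField} {Ψ : Fin 4 → CMType K} {σ : K →+* ℂ} (S : FaceThetaSupply U ι₁ V K Ψ σ) {Hk : HeckeFamily U}
    (hH : U.Fact_pull_hodge) (hW : HeckeWedge10Within U Hk) (hT : S.TranslateClosed Hk) : S.Wedge := by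
  obtain ⟨Γ, ⟨ω₀, h₀, hne₀⟩, ⟨ω₁, h₁, hne₁⟩⟩ := S.supply
  obtain ⟨Γ', g, hg, h, hh, hcup⟩ := hW L ι₁ V Γ ω₀ ω₁
    (Universe.Uiso_le_piece10 hH Γ K (Ψ 0) σ (S.Theta_sub 0 Γ h₀))
    (Universe.Uiso_le_piece10 hH Γ K (Ψ 1) σ (S.Theta_sub 1 Γ h₁)) hne₀ hne₁
  exact ⟨Γ', U.pullC g 1 ω₀, hT 0 Γ Γ' g hg ω₀ h₀, U.pullC h 1 ω₁, hT 1 Γ Γ' h hh ω₁ h₁, hcup⟩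

/-! ## §3  Bridge to the socket: `lineField` from the cohomological wedge; the constructor of `FaceThetaDatum` -/

/-- **The Matsushima embedding is non-zero on non-zero (2,0)-classes** whenever Petersson = cup pairing (item (iii)'s
`inner_emb`, socket field :94) and Hodge–Riemann (2,0) hold at the level: `⟪emb x, emb x⟫ = c · tr(x ∪ conj x) ≠ 0`. [folklore] -/
theorem emb_ne_zero_of_hodgeRiemann {U : Universe} {X : U.Var} {HG : Type} [NormedAddCommGroup HG]
    [InnerProductSpace ℂ HG] (emb : U.CohC X 2 →ₗ[ℂ] HG)
    (hinner : ∃ c : ℂ, c ≠ 0 ∧ ∀ x y : U.CohC X 2, x ∈ (U.hodge X 2).F 2 → y ∈ (U.hodge X 2).F 2 →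
      ⟪emb y, emb x⟫_ℂ = c * U.trC X 4 (U.cup2C X 2 x (conj y)))
    (hHR : ∀ η : U.CohC X 2, η ∈ (U.hodge X 2).F 2 → η ≠ 0 → U.trC X 4 (U.cup2C X 2 η (conj η)) ≠ 0)
    {x : U.CohC X 2} (hx : x ∈ (U.hodge X 2).F 2) (h0 : x ≠ 0) : emb x ≠ 0 := by
  obtain ⟨c, hc, hcΛ⟩ := hinner
  intro he
  have h := hcΛ x x hx hx
  rw [he, inner_zero_left] at h
  exact (mul_ne_zero hc (hHR x hx h0)) h.symm

/-- **The socket field `lineField` from item (vi-c)'s cohomological wedge** (plus item (iii)'s `inner_emb` and Hodge–Riemann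
(2,0) on the surfaces of the tower — a THEOREM on the model universe, `Model.universeOf_hodgeRiemann_pms`,
`B01/HodgeRiemannPeriod.lean:92`): a theta (12)-wedge `ω₁ ∪ ω₂ ≠ 0` of `U_Ψ`-classes is a non-zero `(2,0)`-class
(`Universe.cup2C_mem_F_two_of_Uiso`), hence has non-zero `L²`-image. [folklore] -/
theorem FaceThetaSupply.lineField_of_wedge {U : Universe} {L : CMField} {ι₁ : L →+* ℂ} {V : HermSpace3 L ι₁}
    {K : CMField} {Ψ : Fin 4 → CMType K} {σ : K →+* ℂ} (S : FaceThetaSupply U ι₁ V K Ψ σ)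
    (hH : U.Fact_pull_hodge) (hcup2 : U.Fact_cup2_hodge) {HG : Type} [NormedAddCommGroup HG] [InnerProductSpace ℂ HG]
    (emb : ∀ Γ : Level V, U.CohC (U.pms L ι₁ V Γ) 2 →ₗ[ℂ] HG)
    (inner_emb : ∀ Γ : Level V, ∃ c : ℂ, c ≠ 0 ∧ ∀ x y : U.CohC (U.pms L ι₁ V Γ) 2,
      x ∈ (U.hodge (U.pms L ι₁ V Γ) 2).F 2 → y ∈ (U.hodge (U.pms L ι₁ V Γ) 2).F 2 →
        ⟪emb Γ y, emb Γ x⟫_ℂ = c * U.trC (U.pms L ι₁ V Γ) 4 (U.cup2C (U.pms L ι₁ V Γ) 2 x (conj y)))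
    (hHR : ∀ (Γ : Level V) (η : U.CohC (U.pms L ι₁ V Γ) 2), η ∈ (U.hodge (U.pms L ι₁ V Γ) 2).F 2 → η ≠ 0 →
      U.trC (U.pms L ι₁ V Γ) 4 (U.cup2C (U.pms L ι₁ V Γ) 2 η (conj η)) ≠ 0)
    (hw : S.Wedge) :
    ∃ (Γ : Level V), ∃ ω₁ ∈ S.Theta 0 Γ, ∃ ω₂ ∈ S.Theta 1 Γ, emb Γ (U.cup2C (U.pms L ι₁ V Γ) 1 ω₁ ω₂) ≠ 0 := by
  obtain ⟨Γ, ω₁, h₁, ω₂, h₂, hne⟩ := hw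
  refine ⟨Γ, ω₁, h₁, ω₂, h₂, ?_⟩
  exact emb_ne_zero_of_hodgeRiemann (emb Γ) (inner_emb Γ) (hHR Γ)
    (Universe.cup2C_mem_F_two_of_Uiso hH hcup2 Γ K (Ψ 0) (Ψ 1) σ (S.Theta_sub 0 Γ h₁) (S.Theta_sub 1 Γ h₂)) hne

/-- **The constructor of the socket datum from the items, BY FIELD** — item (vi) supplies `Theta`, `Theta_sub` (this datum)
and `lineField` (from `Wedge`, `lineField_of_wedge`); items (i)/(iii) supply `HG`, `emb`, `cover`, `emb_cover`, `inner_emb`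
(binders here, typed by tr-typer-1/3); item (v) supplies `coupling` for THESE theta sets (binder, typed by tr-typer-5).
Nothing is discharged; this only fixes which field is whose. [folklore] -/
def FaceThetaSupply.toFaceThetaDatum {U : Universe} {L : CMField} {ι₁ : L →+* ℂ} {V : HermSpace3 L ι₁}
    {K : CMField} {Ψ : Fin 4 → CMType K} {σ : K →+* ℂ} (S : FaceThetaSupply U ι₁ V K Ψ σ)
    (HG : Type) [NormedAddCommGroup HG] [InnerProductSpace ℂ HG]
    (emb : ∀ Γ : Level V, U.CohC (U.pms L ι₁ V Γ) 2 →ₗ[ℂ] HG)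
    (lineField : ∃ (Γ : Level V), ∃ ω₁ ∈ S.Theta 0 Γ, ∃ ω₂ ∈ S.Theta 1 Γ,
      emb Γ (U.cup2C (U.pms L ι₁ V Γ) 1 ω₁ ω₂) ≠ 0)
    (coupling : ∀ (Γ : Level V) (ω₁ ω₂ : U.CohC (U.pms L ι₁ V Γ) 1), ω₁ ∈ S.Theta 0 Γ → ω₂ ∈ S.Theta 1 Γ →
      emb Γ (U.cup2C (U.pms L ι₁ V Γ) 1 ω₁ ω₂) ∈ (Submodule.span ℂ
        {x : HG | ∃ (Γ' : Level V), ∃ ω₃ ∈ S.Theta 2 Γ', ∃ ω₄ ∈ S.Theta 3 Γ',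
          x = emb Γ' (U.cup2C (U.pms L ι₁ V Γ') 1 ω₃ ω₄)}).topologicalClosure)
    (cover : ∀ (Γ Γ' : Level V), Γ' ≤ Γ → U.Mor (U.pms L ι₁ V Γ') (U.pms L ι₁ V Γ))
    (emb_cover : ∀ (Γ Γ' : Level V) (h : Γ' ≤ Γ) (x : U.CohC (U.pms L ι₁ V Γ) 2),
      emb Γ' (U.pullC (cover Γ Γ' h) 2 x) = emb Γ x)
    (inner_emb : ∀ Γ : Level V, ∃ c : ℂ, c ≠ 0 ∧ ∀ x y : U.CohC (U.pms L ι₁ V Γ) 2,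
      x ∈ (U.hodge (U.pms L ι₁ V Γ) 2).F 2 → y ∈ (U.hodge (U.pms L ι₁ V Γ) 2).F 2 →
        ⟪emb Γ y, emb Γ x⟫_ℂ = c * U.trC (U.pms L ι₁ V Γ) 4 (U.cup2C (U.pms L ι₁ V Γ) 2 x (conj y))) :
    U.FaceThetaDatum ι₁ V K Ψ σ where
  HG := HG
  emb := emb
  Theta := S.Theta
  Theta_sub := S.Theta_sub
  lineField := lineField
  coupling := coupling
  cover := cover
  emb_cover := emb_cover
  inner_emb := inner_emb

/-! ## §4  The typed axiom of item (vi): ∃ι₁ ∃V ∃Γ form; projections; ∀V → ∃V; falsity on the PerL shadow -/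

/-- **ITEM (vi) AS ONE CLOSED STATEMENT, ∃ form** (rfwf v3 §4.2 (vi), tex ll. 261–265, with Thm 4.4's «existence of (V₃,h) by
weak approximation» = the ∃V; RE-POINT (1)(2): one admissible `ι₁`, one `V`, one level per field-and-face): for every Galois CM
field `F` with `6 ≤ [F:ℚ]` and every rank-four face `f` there are an admissible `ι₁`, a hermitian 3-space `V` and a theta supply
datum for `(F, f.psi, ι₁)` on the tower of `V` satisfying Prop 4.3.  The ∀ι₁ ∀V form is PKG `Universe.RealisationExistsFace`
(`StubTree/Inputs.lean:97`) restricted to the fields `Theta/Theta_sub/lineField`.  Displayed hypothesis; asserted by no one;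
HC_CM is NOT proved. -/
@[conjecture]
def FaceThetaSupplyWedgeExists (U : Universe) : Prop :=
  ∀ (F : CMField), IsGalois ℚ F → 6 ≤ Module.finrank ℚ F → ∀ f : Face F,
    ∃ ι₁ : F →+* ℂ, f.Admissible ι₁ ∧ ∃ (V : HermSpace3 F ι₁) (S : FaceThetaSupply U ι₁ V F f.psi ι₁), S.Wedge

/-- **Projection to the ∃-witness form of B01-L** (`Universe.FaceLineField` at one `(ι₁, V)` per face; cf.
`CorCM/FacePeriodWitnesses.lean`: the chain to `HC_CM` consumes one witness per face). [folklore] -/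
theorem exists_lineField_witness {U : Universe} (h : FaceThetaSupplyWedgeExists U) :
    ∀ (F : CMField), IsGalois ℚ F → 6 ≤ Module.finrank ℚ F → ∀ f : Face F,
      ∃ ι₁ : F →+* ℂ, f.Admissible ι₁ ∧ ∃ (V : HermSpace3 F ι₁) (Γ : Level V) (ω₀ ω₁ : U.CohC (U.pms F ι₁ V Γ) 1),
        ω₀ ∈ U.Uiso Γ F (f.psi 0) ι₁ ∧ ω₁ ∈ U.Uiso Γ F (f.psi 1) ι₁ ∧ U.cup2C (U.pms F ι₁ V Γ) 1 ω₀ ω₁ ≠ 0 := by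
  intro F hG h6 f
  obtain ⟨ι₁, hι, V, S, hS⟩ := h F hG h6 f
  obtain ⟨Γ, ω₀, ω₁, h₀, h₁, hne⟩ := S.exists_Uiso_cup_ne_zero hS
  exact ⟨ι₁, hι, V, Γ, ω₀, ω₁, h₀, h₁, hne⟩

/-- **Projection to the ∃-witness form of B01-S** (`Universe.FaceSupply` at one `(ι₁, V)` per face). [folklore] -/
theorem exists_supply_witness {U : Universe} (h : FaceThetaSupplyWedgeExists U) :
    ∀ (F : CMField), IsGalois ℚ F → 6 ≤ Module.finrank ℚ F → ∀ f : Face F,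
      ∃ ι₁ : F →+* ℂ, f.Admissible ι₁ ∧ ∃ (V : HermSpace3 F ι₁) (Γ : Level V) (ω₀ ω₁ : U.CohC (U.pms F ι₁ V Γ) 1),
        ω₀ ∈ U.Uiso Γ F (f.psi 0) ι₁ ∧ ω₁ ∈ U.Uiso Γ F (f.psi 1) ι₁ ∧ ω₀ ≠ 0 ∧ ω₁ ≠ 0 := by
  intro F hG h6 f
  obtain ⟨ι₁, hι, V, S, -⟩ := h F hG h6 f
  obtain ⟨Γ, ω₀, ω₁, h₀, h₁, hne₀, hne₁⟩ := S.exists_Uiso_ne_zero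
  exact ⟨ι₁, hι, V, Γ, ω₀, ω₁, h₀, h₁, hne₀, hne₁⟩

/-- **The ∀ι₁ ∀V form implies the ∃ form** (one admissible `ι₁` per face: `StubTree.admissible_exists`; one hermitian space:
Landherr, `landherr_exists_proof` — both tree theorems), recorded to show the ∃-interface is the weaker one. [folklore] -/
theorem faceThetaSupplyWedgeExists_of_forall {U : Universe}
    (h : ∀ (F : CMField), IsGalois ℚ F → 6 ≤ Module.finrank ℚ F → ∀ (f : Face F) (ι₁ : F →+* ℂ), f.Admissible ι₁ →
      ∀ V : HermSpace3 F ι₁, ∃ S : FaceThetaSupply U ι₁ V F f.psi ι₁, S.Wedge) :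
    FaceThetaSupplyWedgeExists U := by
  intro F hG h6 f
  obtain ⟨ι₁, hι⟩ := StubTree.admissible_exists F h6 f
  obtain ⟨V⟩ := landherr_exists_proof F ι₁
  exact ⟨ι₁, hι, V, h F hG h6 f ι₁ hι V⟩

/-- **Item (vi) FAILS on the PerL shadow** of every universe: at `F = ℚ(ζ₇)` (Galois, degree `6 ∉ {24, 48}`) every
`U_Ψ(Γ)` of the shadow is `⊥` (`Universe.perLShadow_Uiso_eq_bot`), so no supply datum exists at any `(ι₁, V)` — the
non-vanishing clause `supply` already fails.  Hence the statement is not vacuous bookkeeping and, like B01-S/B01-L, not a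
universe-uniform consequence of `PerL`. [folklore] -/
theorem not_faceThetaSupplyWedgeExists_perLShadow (U : Universe) : ¬ FaceThetaSupplyWedgeExists U.perLShadow := by
  intro h
  let F : CMField := ⟨CyclotomicField.{0} 7 ℚ⟩
  have hG : IsGalois ℚ F := isGalois_cyclotomicField_seven
  have h6 : Module.finrank ℚ F = 6 := Literature.NumberTheory.Automorphic.UnitaryGroup.finrank_cyclotomicField_seven
  obtain ⟨f, -, -⟩ := exists_face_admissible F h6.ge
  obtain ⟨ι₁, -, V, S, -⟩ := h F hG h6.ge f
  obtain ⟨Γ, ⟨ω₀, h₀, hne₀⟩, -⟩ := S.supply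
  have h₀' : ω₀ ∈ U.perLShadow.Uiso Γ F (f.psi 0) ι₁ := S.Theta_sub 0 Γ h₀
  rw [U.perLShadow_Uiso_eq_bot (by omega) ι₁ V Γ F (f.psi 0) ι₁, Submodule.mem_bot] at h₀'
  exact hne₀ h₀'

/-- Hence item (vi) is not a universe-uniform consequence of `PerL` (relative to M13 + M14). [folklore] -/
theorem not_forall_perL_imp_faceThetaSupplyWedgeExists (U : Universe) (hE : U.Fact_eigenLine) (hA : U.Fact_alphaLine) :
    ¬ ∀ U' : Universe, U'.PerL → FaceThetaSupplyWedgeExists U' :=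
  fun h => not_faceThetaSupplyWedgeExists_perLShadow U (h _ (U.perLShadow_perL hE hA))

/-! ## §5  Toward the day-1 assembly: item (vi) + the other items' fields at the SAME `(ι₁, V)` give the socket datum -/

/-- **`RealisationExistsFace∃` (socket form, = `Universe.FaceThetaDataExists` of `B01/Transposition/Assembly.lean`, stated
UNFOLDED) from the items delivered jointly per field-and-face**: at one admissible `ι₁` and one `V` — item (vi)'s supply datum
with Prop 4.3, items (i)/(iii)'s `L²` dictionary (`HG`, `emb`, `cover`, `emb_cover`, `inner_emb`), item (v)'s coupling for
the supplied theta sets — together with Hodge–Riemann (2,0) on the tower and the two Hodge-type facts, give a `FaceThetaDatum`.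
The quantifier shape is the point: ∃ι₁ ∃V OUTSIDE the conjunction of the items (RE-POINT (1)). [folklore] -/
theorem exists_faceThetaDatum_of_items {U : Universe} (hH : U.Fact_pull_hodge) (hcup2 : U.Fact_cup2_hodge)
    (hHR : ∀ {L : CMField} {ι₁ : L →+* ℂ} {V : HermSpace3 L ι₁} (Γ : Level V) (η : U.CohC (U.pms L ι₁ V Γ) 2),
      η ∈ (U.hodge (U.pms L ι₁ V Γ) 2).F 2 → η ≠ 0 → U.trC (U.pms L ι₁ V Γ) 4 (U.cup2C (U.pms L ι₁ V Γ) 2 η (conj η)) ≠ 0)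
    (h : ∀ (F : CMField), IsGalois ℚ F → 6 ≤ Module.finrank ℚ F → ∀ f : Face F,
      ∃ ι₁ : F →+* ℂ, f.Admissible ι₁ ∧ ∃ (V : HermSpace3 F ι₁) (S : FaceThetaSupply U ι₁ V F f.psi ι₁)
        (HG : Type) (_ : NormedAddCommGroup HG) (_ : InnerProductSpace ℂ HG)
        (emb : ∀ Γ : Level V, U.CohC (U.pms F ι₁ V Γ) 2 →ₗ[ℂ] HG)
        (cover : ∀ (Γ Γ' : Level V), Γ' ≤ Γ → U.Mor (U.pms F ι₁ V Γ') (U.pms F ι₁ V Γ)),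
        S.Wedge ∧
        (∀ (Γ : Level V) (ω₁ ω₂ : U.CohC (U.pms F ι₁ V Γ) 1), ω₁ ∈ S.Theta 0 Γ → ω₂ ∈ S.Theta 1 Γ →
          emb Γ (U.cup2C (U.pms F ι₁ V Γ) 1 ω₁ ω₂) ∈ (Submodule.span ℂ
            {x : HG | ∃ (Γ' : Level V), ∃ ω₃ ∈ S.Theta 2 Γ', ∃ ω₄ ∈ S.Theta 3 Γ',
              x = emb Γ' (U.cup2C (U.pms F ι₁ V Γ') 1 ω₃ ω₄)}).topologicalClosure) ∧
        (∀ (Γ Γ' : Level V) (hle : Γ' ≤ Γ) (x : U.CohC (U.pms F ι₁ V Γ) 2),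
          emb Γ' (U.pullC (cover Γ Γ' hle) 2 x) = emb Γ x) ∧
        (∀ Γ : Level V, ∃ c : ℂ, c ≠ 0 ∧ ∀ x y : U.CohC (U.pms F ι₁ V Γ) 2,
          x ∈ (U.hodge (U.pms F ι₁ V Γ) 2).F 2 → y ∈ (U.hodge (U.pms F ι₁ V Γ) 2).F 2 →
            ⟪emb Γ y, emb Γ x⟫_ℂ = c * U.trC (U.pms F ι₁ V Γ) 4 (U.cup2C (U.pms F ι₁ V Γ) 2 x (conj y)))) :
    ∀ (F : CMField), IsGalois ℚ F → 6 ≤ Module.finrank ℚ F → ∀ f : Face F,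
      ∃ ι₁ : F →+* ℂ, f.Admissible ι₁ ∧ ∃ V : HermSpace3 F ι₁, Nonempty (U.FaceThetaDatum ι₁ V F f.psi ι₁) := by
  intro F hG h6 f
  obtain ⟨ι₁, hι, V, S, HG, _, _, emb, cover, hw, hcoup, hcov, hinner⟩ := h F hG h6 f
  exact ⟨ι₁, hι, V, ⟨S.toFaceThetaDatum HG emb (S.lineField_of_wedge hH hcup2 emb hinner hHR hw) hcoup cover hcov hinner⟩⟩

end Transposition

/-! ## §6  The model universe: Hodge–Riemann (2,0) is a theorem there -/

namespace Model

open Literature.NumberTheory.Automorphic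
open Literature.NumberTheory.Automorphic.PicardCM
open Literature.AlgebraicGeometry.HodgeTheory

/-- **On the model universe the socket field `lineField` follows from item (vi-c)'s cohomological wedge and item (iii)'s
`inner_emb` alone** (Hodge–Riemann (2,0) = `universeOf_hodgeRiemann_pms`, the Hodge-type facts = `universeOf_fact_pull_hodge`,
`universeOf_fact_cup2_hodge`, all tree theorems). [folklore] -/
theorem universeOf_lineField_of_wedge (hHD : exists_isReal_hodgeModel) (hI : hodgePQ_independent_of_hodgeModel)
    (hU : BallQuotientUniformisedDatum) (h₃ : CMAbelianVarietyRealised) {L : CMField} {ι₁ : L →+* ℂ}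
    {V : HermSpace3 L ι₁} {K : CMField} {Ψ : Fin 4 → CMType K} {σ : K →+* ℂ}
    (S : Transposition.FaceThetaSupply (universeOf hHD hI hU h₃) ι₁ V K Ψ σ)
    {HG : Type} [NormedAddCommGroup HG] [InnerProductSpace ℂ HG]
    (emb : ∀ Γ : Level V, (universeOf hHD hI hU h₃).CohC ((universeOf hHD hI hU h₃).pms L ι₁ V Γ) 2 →ₗ[ℂ] HG)
    (inner_emb : ∀ Γ : Level V, ∃ c : ℂ, c ≠ 0 ∧
      ∀ x y : (universeOf hHD hI hU h₃).CohC ((universeOf hHD hI hU h₃).pms L ι₁ V Γ) 2,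
        x ∈ ((universeOf hHD hI hU h₃).hodge ((universeOf hHD hI hU h₃).pms L ι₁ V Γ) 2).F 2 →
        y ∈ ((universeOf hHD hI hU h₃).hodge ((universeOf hHD hI hU h₃).pms L ι₁ V Γ) 2).F 2 →
          ⟪emb Γ y, emb Γ x⟫_ℂ = c * (universeOf hHD hI hU h₃).trC ((universeOf hHD hI hU h₃).pms L ι₁ V Γ) 4
            ((universeOf hHD hI hU h₃).cup2C ((universeOf hHD hI hU h₃).pms L ι₁ V Γ) 2 x (conj y)))
    (hw : S.Wedge) :
    ∃ (Γ : Level V), ∃ ω₁ ∈ S.Theta 0 Γ, ∃ ω₂ ∈ S.Theta 1 Γ,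
      emb Γ ((universeOf hHD hI hU h₃).cup2C ((universeOf hHD hI hU h₃).pms L ι₁ V Γ) 1 ω₁ ω₂) ≠ 0 :=
  S.lineField_of_wedge (universeOf_fact_pull_hodge hHD hI hU h₃) (universeOf_fact_cup2_hodge hHD hI hU h₃) emb inner_emb
    (fun Γ η hη h0 => universeOf_hodgeRiemann_pms hHD hI hU h₃ V Γ η hη h0) hw

end Model

end Summit.HodgeConjecture.CorCM

end
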